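import Literature.Algebra.EuclideanLattices.ARVerifierRandomWitness
import Mathlib.Data.Real.Pointwise
import HarnessLib

/-!
# Regev 2009, Lemma 3.20: the integer `DGS` query for `(L*, 1/(100d))` — the adjugate dual instance and the scaling of discrete Gaussians

Topic `Algebra/EuclideanLattices` (family `pqc`). Serves the decomposition of the named fact
`Literature.Computability.Cryptography.regev_lwe_to_gapSVP_quantum` (pqc.S19, GapSVP form; Regev,
J. ACM 56 (2009), Thm 1.1), hypothesis `hL` = **Lemma 3.20** of the landed assembly
`regev_lwe_to_gapSVP_quantum_of_dgs` (`Cryptography/RegevReduction.lean`), companion of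
`ARVerifierRandomWitness.lean` (the NO-case analysis).

The reduction of Lemma 3.20 "call[s] the `DGS` oracle `N` times with the lattice `L*` and the value
`1/(100d)`" (arXiv:2401.03703, p. 22). The tree's `DGS` samplers
(`UniformQCircuitFamily.SamplesDGS`, `Cryptography/RegevDGSReduction.lean`) take INTEGER lattice
instances (`LatticeInstance`: an integer basis matrix `B`, rows) and a rational width, so the query
is made in the scaled form `(det B · L(B)*, |det B|/(100d))`: for `B` nonsingular with
`C = adj B` (`B C = C B = det B · 1`), the columns `c₁, …, cₙ` of `C` satisfy
`⟪cₖ, bᵢ⟫ = det B · δᵢₖ`, so `L(Cᵀ) = det B · L(B)*` (the `cₖ/det B` form the dual basis). This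
file records that instance and the bookkeeping the machine form of Lemma 3.20 needs:

* `LatticeInstance.adjDual I = ⟨n, (adj B)ᵀ⟩`; `adjDual_isNonsingular` (`det adj B = (det B)ⁿ⁻¹`);
  `inner_adjCol_vec` (`⟪cₖ, bᵢ⟫ = det B · δ`), `sum_inner_vec_smul_adjCol`
  (`∑ᵢ ⟪x, bᵢ⟫ cᵢ = det B · x`), `mem_adjDualLattice_iff` (`x ∈ L(Cᵀ) ↔ (det B)⁻¹ x ∈ L(B)*`),
  `adjDualLattice_eq_smul` (`L(Cᵀ) = det B • L(B)*`); all stated for `adjDualLattice I`, the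
  lattice of the query instance as a submodule of the ambient `ℝⁿ` of `I` (`adjDual_lattice`:
  `(adjDual I).lattice = adjDualLattice I` by `rfl`, as `(adjDual I).n = I.n` by `rfl`).
* Scaling of lattices: `minNorm_pointwise_smul` (`λ₁(c L) = |c| λ₁(L)`), `dualLattice_pointwise_smul`
  (`(c L)* = c⁻¹ L*`), and of discrete Gaussians: `discreteGaussian_map_val_eq_of_smul`
  (`D_{cL, |c| r} = c · D_{L, r}` as laws on the ambient space, for any discrete `M = c L`).
* Consequences for the query: `dualLattice_adjDualLattice` (`L(Cᵀ)* = (det B)⁻¹ L(B)`),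
  `minNorm_dualLattice_adjDualLattice` (`λ₁(L(Cᵀ)*) = λ₁(L(B))/|det B|`), so that Regev's bound
  `√n γ(n)/λ₁(·*)` (`Regev2009.dgsBoundDual`) evaluated at the query instance is
  `√n γ(n) |det B|/λ₁(L(B))` and the query is admissible (`… < |det B|/(100d)`) exactly when
  `100 √n γ(n) d < λ₁(L(B))` — the first NO condition of `GapCVP′_{100√n·γ}`
  (`div_minNorm_dualLattice_adjDualLattice_lt`); and `discreteGaussian_adjDualLattice_map_val`
  (`D_{L(Cᵀ), |det B|/s}` is the image of `D_{L(B)*, 1/s} = dualGaussian (L(B)) s` under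
  `w ↦ det B · w`), which turns genuine samples of the query into the dual samples of the
  Aharonov–Regev verifier (`ARVerifier.certOf`, `aⱼ = B wⱼ = B vⱼ / det B`).

Everything here is PROVED (definitions with bodies — `LatticeInstance.adjCol`, `adjDualLattice`,
`adjDual` — and theorems; no named fact).

## References

* O. Regev, *On lattices, learning with errors, random linear codes, and cryptography*, J. ACM 56
  (2009), art. 34 = arXiv:2401.03703, Def. 2.9 (`DGS`), Lemma 3.20 and its proof (pp. 21–22)
  [Regev2009].
* D. Micciancio, S. Goldwasser, *Complexity of Lattice Problems*, Kluwer 2002, Ch. 1 §1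
  (dual lattice, dual basis `B⁻ᵀ`) [MicciancioGoldwasser2002].
* D. Micciancio, O. Regev, *Worst-case to average-case reductions based on Gaussian measures*,
  SIAM J. Comput. 37 (2007), §2 (discrete Gaussian; scaling) [MicciancioRegev2007].
-/

noncomputable section

open Matrix Module Submodule
open scoped Real InnerProductSpace Pointwise ENNReal

namespace Literature.Algebra.EuclideanLattices

/-! ### Scaling a lattice: minimum distance, dual, discrete Gaussian -/

section Scaling

variable {E : Type*} [NormedAddCommGroup E] [InnerProductSpace ℝ E]

/-- The nonzero vectors of `c • L` are the `c`-multiples of the nonzero vectors of `L` (`c ≠ 0`).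
[folklore] -/
theorem setOf_mem_pointwise_smul_ne_zero (L : Submodule ℤ E) {c : ℝ} (hc : c ≠ 0) :
    {x : E | x ∈ c • L ∧ x ≠ 0} = c • {y : E | y ∈ L ∧ y ≠ 0} := by
  ext x
  rw [Set.mem_smul_set_iff_inv_smul_mem₀ hc]
  simp only [Set.mem_setOf_eq, ne_eq, smul_eq_zero, inv_eq_zero, hc, false_or]
  constructor
  · rintro ⟨hx, hx0⟩
    rw [Submodule.mem_smul_pointwise_iff_exists] at hx
    obtain ⟨y, hy, rfl⟩ := hx
    refine ⟨?_, by simpa [smul_eq_zero, hc] using hx0⟩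
    rwa [smul_smul, inv_mul_cancel₀ hc, one_smul]
  · rintro ⟨hx, hx0⟩
    refine ⟨?_, hx0⟩
    have : x = c • (c⁻¹ • x) := by rw [smul_smul, mul_inv_cancel₀ hc, one_smul]
    rw [this]
    exact Submodule.smul_mem_pointwise_smul _ _ _ hx

/-- **Minimum distance of a scaled lattice**: `λ₁(c • L) = |c| · λ₁(L)` for `c ≠ 0`.
[cite: MicciancioGoldwasser2002, Ch. 1 §1] -/
theorem minNorm_pointwise_smul (L : Submodule ℤ E) {c : ℝ} (hc : c ≠ 0) :
    minNorm (c • L) = |c| * minNorm L := by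
  unfold minNorm
  rw [setOf_mem_pointwise_smul_ne_zero L hc]
  have himg : (‖·‖) '' (c • {y : E | y ∈ L ∧ y ≠ 0}) = |c| • ((‖·‖) '' {y : E | y ∈ L ∧ y ≠ 0}) := by
    ext r
    simp only [Set.mem_image, Set.mem_smul_set, smul_eq_mul]
    constructor
    · rintro ⟨_, ⟨y, hy, rfl⟩, rfl⟩
      exact ⟨‖y‖, ⟨y, hy, rfl⟩, by rw [norm_smul, Real.norm_eq_abs]⟩
    · rintro ⟨_, ⟨y, hy, rfl⟩, rfl⟩
      exact ⟨c • y, ⟨y, hy, rfl⟩, by rw [norm_smul, Real.norm_eq_abs]⟩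
  rw [himg, Real.sInf_smul_of_nonneg (abs_nonneg c), smul_eq_mul]

/-- **Dual of a scaled lattice**: `(c • L)* = c⁻¹ • L*` for `c ≠ 0` (`⟪x, c y⟫ = ⟪c x, y⟫`).
[cite: MicciancioGoldwasser2002, Ch. 1 §1] -/
theorem dualLattice_pointwise_smul (L : Submodule ℤ E) {c : ℝ} (hc : c ≠ 0) :
    dualLattice (c • L) = c⁻¹ • dualLattice L := by
  ext x
  rw [Submodule.mem_smul_pointwise_iff_exists, mem_dualLattice]
  constructor
  · intro h
    refine ⟨c • x, mem_dualLattice.2 fun y hy ↦ ?_, by rw [smul_smul, inv_mul_cancel₀ hc, one_smul]⟩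
    obtain ⟨m, hm⟩ := h (c • y) (Submodule.smul_mem_pointwise_smul _ _ _ hy)
    exact ⟨m, by rw [hm, real_inner_smul_left, real_inner_smul_right]⟩
  · rintro ⟨z, hz, rfl⟩ y hy
    rw [Submodule.mem_smul_pointwise_iff_exists] at hy
    obtain ⟨y', hy', rfl⟩ := hy
    obtain ⟨m, hm⟩ := mem_dualLattice.1 hz y' hy'
    refine ⟨m, ?_⟩
    rw [hm, real_inner_smul_left, real_inner_smul_right, ← mul_assoc, inv_mul_cancel₀ hc, one_mul]

omit [InnerProductSpace ℝ E] in
/-- `ρ_{|c| r} = ρ_{c r}` (the Gaussian depends on the square of the parameter). [folklore] -/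
theorem gaussianFunction_abs_mul (c r : ℝ) (x : E) :
    gaussianFunction (|c| * r) x = gaussianFunction (c * r) x := by
  simp only [gaussianFunction, mul_pow, sq_abs]

variable [FiniteDimensional ℝ E]

/-- **Scaling of discrete Gaussians**: if `M = c • L` (as sets; `c ≠ 0`, both discrete) then the
law `D_{M, |c| r}` on the ambient space is the image of `D_{L, r}` under `y ↦ c • y`
(`ρ_{|c| r}(c y) = ρ_r(y)` termwise, and the normalising sums agree along the bijection
`y ↦ c y : L ≃ M`). [cite: MicciancioRegev2007, §2] -/
theorem discreteGaussian_map_val_eq_of_smul {L M : Submodule ℤ E} [DiscreteTopology L] [DiscreteTopology M]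
    {c : ℝ} (hc : c ≠ 0) (hM : ∀ x : E, x ∈ M ↔ c⁻¹ • x ∈ L) {r : ℝ} (hr : 0 < r) :
    (discreteGaussian M (|c| * r) 0).map Subtype.val =
      (discreteGaussian L r 0).map fun y : L ↦ c • (y : E) := by
  have hcr : 0 < |c| * r := mul_pos (abs_pos.2 hc) hr
  have hmem : ∀ y : L, c • (y : E) ∈ M := fun y ↦
    (hM _).2 (by rw [smul_smul, inv_mul_cancel₀ hc, one_smul]; exact y.2)
  have hmem' : ∀ x : M, c⁻¹ • (x : E) ∈ L := fun x ↦ (hM _).1 x.2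
  let e : L ≃ M :=
    { toFun := fun y ↦ ⟨c • (y : E), hmem y⟩
      invFun := fun x ↦ ⟨c⁻¹ • (x : E), hmem' x⟩
      left_inv := fun y ↦ Subtype.ext (by simp [smul_smul, inv_mul_cancel₀ hc])
      right_inv := fun x ↦ Subtype.ext (by simp [smul_smul, mul_inv_cancel₀ hc]) }
  have he : ∀ y : L, ((e y : M) : E) = c • (y : E) := fun _ ↦ rfl
  -- termwise equality of the weights
  have hw : ∀ y : L, gaussianFunction (|c| * r) ((e y : M) : E) = gaussianFunction r (y : E) := fun y ↦ by
    rw [he, gaussianFunction_abs_mul, gaussianFunction_smul r hc]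
  -- the normalising constants agree
  have hZ : gaussianMass (|c| * r) 0 (M : Set E) = gaussianMass r 0 (L : Set E) := by
    unfold gaussianMass
    simp only [sub_zero]
    change ∑' x : M, ENNReal.ofReal (gaussianFunction (|c| * r) (x : E)) =
      ∑' y : L, ENNReal.ofReal (gaussianFunction r (y : E))
    rw [← Equiv.tsum_eq e]
    exact tsum_congr fun y ↦ by rw [hw]
  -- the PMFs agree along `e`
  have h1 : discreteGaussian M (|c| * r) 0 = (discreteGaussian L r 0).map e := by
    ext x
    rw [PMF.map_apply, tsum_eq_single (e.symm x)]
    · rw [if_pos (e.apply_symm_apply x).symm, discreteGaussian_apply _ hcr, discreteGaussian_apply _ hr,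
        sub_zero, sub_zero, hZ]
      congr 2
      conv_lhs => rw [← e.apply_symm_apply x]
      exact hw _
    · intro y hy
      rw [if_neg]
      intro h
      exact hy (by rw [h, Equiv.symm_apply_apply])
  rw [h1, PMF.map_comp]
  rfl

end Scaling

/-! ### The adjugate dual instance -/

namespace LatticeInstance

variable (I : LatticeInstance)

/-- The `k`-th column `cₖ` of the adjugate `adj B`, as a vector of `ℝⁿ`. [folklore] -/
def adjCol (k : Fin I.n) : EuclideanSpace ℝ (Fin I.n) :=
  intVecToEuclidean I.n fun j => I.basis.adjugate j k

/-- Entries of `adjCol`. [folklore] -/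
@[simp] theorem adjCol_apply (k j : Fin I.n) : I.adjCol k j = ((I.basis.adjugate j k : ℤ) : ℝ) := rfl

/-- **The scaled dual lattice `L((adj B)ᵀ) = span_ℤ {c₁, …, cₙ}`** generated by the columns of the
adjugate, as a submodule of the ambient `ℝⁿ` of `I` (for `B` nonsingular it is `det B · L(B)*`,
`adjDualLattice_eq_smul`). [cite: MicciancioGoldwasser2002, Ch. 1 §1] -/
def adjDualLattice : Submodule ℤ (EuclideanSpace ℝ (Fin I.n)) :=
  span ℤ (Set.range I.adjCol)

/-- **The integer instance of the scaled dual lattice**: `adjDual ⟨n, B⟩ = ⟨n, (adj B)ᵀ⟩`, whose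
rows are the columns `c₁, …, cₙ` of `adj B`. This is the lattice handed to the `DGS` oracle by
Regev's Lemma 3.20 in place of `L*` (with the width scaled by `|det B|`); its lattice is
`adjDualLattice I` (`adjDual_lattice`, definitionally — note `(adjDual I).n = I.n` holds by `rfl`,
so statements about the query instance produced by `UniformQCircuitFamily.SamplesDGS` can be
`change`d into the `adjDualLattice` form). [cite: Regev2009, Lemma 3.20 (proof)] -/
def adjDual : LatticeInstance :=
  ⟨I.n, I.basis.adjugateᵀ⟩

/-- The dimension of `adjDual I` is `n`. [folklore] -/
@[simp] theorem adjDual_n : I.adjDual.n = I.n := rfl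

/-- The basis matrix of `adjDual I` is `(adj B)ᵀ`. [folklore] -/
theorem adjDual_basis : I.adjDual.basis = I.basis.adjugateᵀ := rfl

/-- The rows of `adjDual I` are the columns of `adj B`. [folklore] -/
theorem adjDual_vec : I.adjDual.vec = I.adjCol := rfl

/-- The lattice of the instance `adjDual I` is `adjDualLattice I` (definitionally). [folklore] -/
theorem adjDual_lattice : I.adjDual.lattice = I.adjDualLattice := rfl

/-- `adjDualLattice I` is a discrete subgroup (it is the lattice of an integer instance). [folklore] -/
instance instDiscreteTopologyAdjDualLattice : DiscreteTopology I.adjDualLattice :=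
  LatticeInstance.instDiscreteTopologyLattice I.adjDual

variable {I}

/-- `adjDual I` is nonsingular when `I` is: `det (adj B)ᵀ = (det B)ⁿ⁻¹ ≠ 0`.
[cite: MicciancioGoldwasser2002, Ch. 1 §1] -/
theorem adjDual_isNonsingular (hI : I.IsNonsingular) : I.adjDual.IsNonsingular := by
  change (I.basis.adjugateᵀ).det ≠ 0
  rw [det_transpose, det_adjugate]
  exact pow_ne_zero _ hI

/-- Pairings with the basis rows are the entries of `B x`: `⟪x, bᵢ⟫ = (B x)ᵢ`. [folklore] -/
theorem inner_vec_eq_mulVec (x : EuclideanSpace ℝ (Fin I.n)) (i : Fin I.n) :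
    ⟪x, I.vec i⟫_ℝ = ((I.basis.map (Int.castRingHom ℝ)) *ᵥ ARVerifier.coords x) i := by
  rw [ARVerifier.inner_eq_dotProduct, dotProduct_comm]
  rfl

/-- The coordinates of `cₖ` are the `k`-th column of `adj (B : ℝⁿˣⁿ)`. [folklore] -/
theorem coords_adjCol (k : Fin I.n) :
    ARVerifier.coords (I.adjCol k) = fun j => (I.basis.map (Int.castRingHom ℝ)).adjugate j k := by
  rw [ARVerifier.adjugate_map_basis]
  rfl

/-- **The columns of the adjugate pair integrally with the basis**: `⟪cₖ, bᵢ⟫ = det B · δᵢₖ`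
(`B · adj B = det B · 1`). [cite: MicciancioGoldwasser2002, Ch. 1 §1] -/
theorem inner_adjCol_vec (k i : Fin I.n) :
    ⟪I.adjCol k, I.vec i⟫_ℝ = if i = k then (I.basis.det : ℝ) else 0 := by
  rw [inner_vec_eq_mulVec, coords_adjCol]
  change ∑ j, (I.basis.map (Int.castRingHom ℝ)) i j * (I.basis.map (Int.castRingHom ℝ)).adjugate j k = _
  rw [← Matrix.mul_apply, Matrix.mul_adjugate, Matrix.smul_apply, Matrix.one_apply, smul_eq_mul,
    ARVerifier.cast_det_basis]
  simp only [mul_ite, mul_one, mul_zero]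

/-- **Reconstruction from the pairings** (`adj B · B = det B · 1`): for every `x ∈ ℝⁿ`,
`∑ᵢ ⟪x, bᵢ⟫ cᵢ = det B · x`. [cite: MicciancioGoldwasser2002, Ch. 1 §1] -/
theorem sum_inner_vec_smul_adjCol (x : EuclideanSpace ℝ (Fin I.n)) :
    ∑ i, ⟪x, I.vec i⟫_ℝ • I.adjCol i = (I.basis.det : ℝ) • x := by
  set Br : Matrix (Fin I.n) (Fin I.n) ℝ := I.basis.map (Int.castRingHom ℝ) with hBr
  have hCr : ∀ j i, ((I.basis.adjugate j i : ℤ) : ℝ) = Br.adjugate j i := fun j i => by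
    rw [hBr, ARVerifier.adjugate_map_basis]; rfl
  ext j
  rw [PiLp.smul_apply, smul_eq_mul, WithLp.ofLp_sum, Finset.sum_apply]
  simp only [WithLp.ofLp_smul, Pi.smul_apply, smul_eq_mul, inner_vec_eq_mulVec]
  change ∑ i, (Br *ᵥ ARVerifier.coords x) i * ((I.basis.adjugate j i : ℤ) : ℝ) = (I.basis.det : ℝ) * ARVerifier.coords x j
  simp_rw [hCr]
  have h : ∑ i, (Br *ᵥ ARVerifier.coords x) i * Br.adjugate j i = (Br.adjugate *ᵥ (Br *ᵥ ARVerifier.coords x)) j := by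
    rw [Matrix.mulVec, dotProduct]
    exact Finset.sum_congr rfl fun i _ => mul_comm _ _
  rw [h, Matrix.mulVec_mulVec, Matrix.adjugate_mul, Matrix.smul_mulVec, Matrix.one_mulVec, Pi.smul_apply,
    smul_eq_mul, ARVerifier.cast_det_basis]

/-- Membership in `L(B)*` is tested on the basis vectors: `w ∈ L(B)* ↔ ∀ i, ⟪w, bᵢ⟫ ∈ ℤ`.
[cite: MicciancioGoldwasser2002, Ch. 1 §1] -/
theorem mem_dualLattice_iff_forall_vec (w : EuclideanSpace ℝ (Fin I.n)) :
    w ∈ dualLattice I.lattice ↔ ∀ i, ∃ m : ℤ, (m : ℝ) = ⟪w, I.vec i⟫_ℝ := by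
  constructor
  · intro hw i
    exact mem_dualLattice.1 hw _ (subset_span (Set.mem_range_self i))
  · intro h
    refine mem_dualLattice.2 fun y hy ↦ ?_
    obtain ⟨z, rfl⟩ := (I.mem_lattice_iff y).1 hy
    choose m hm using h
    refine ⟨∑ i, z i * m i, ?_⟩
    rw [ofCoeffs_eq_sum, inner_sum]
    push_cast
    refine Finset.sum_congr rfl fun i _ ↦ ?_
    rw [inner_smul_right_eq_smul, zsmul_eq_mul, hm]

/-- Integer combinations of the `cᵢ` are real combinations with integer coefficients. [folklore] -/
theorem sum_zsmul_adjCol (z : Fin I.n → ℤ) : ∑ i, z i • I.adjCol i = ∑ i, ((z i : ℤ) : ℝ) • I.adjCol i :=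
  Finset.sum_congr rfl fun i _ => (Int.cast_smul_eq_zsmul ℝ (z i) (I.adjCol i)).symm

/-- **`x ∈ L((adj B)ᵀ)` iff `(det B)⁻¹ x ∈ L(B)*`** (`B` nonsingular): the columns of
`adj B = det B · B⁻¹` generate `det B` times the dual lattice.
[cite: MicciancioGoldwasser2002, Ch. 1 §1 (dual basis `B⁻ᵀ`)] -/
theorem mem_adjDualLattice_iff (hI : I.IsNonsingular) (x : EuclideanSpace ℝ (Fin I.n)) :
    x ∈ I.adjDualLattice ↔ (I.basis.det : ℝ)⁻¹ • x ∈ dualLattice I.lattice := by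
  have hD : (I.basis.det : ℝ) ≠ 0 := by exact_mod_cast hI
  rw [mem_dualLattice_iff_forall_vec, adjDualLattice, Submodule.mem_span_range_iff_exists_fun]
  constructor
  · rintro ⟨z, rfl⟩ i
    refine ⟨z i, ?_⟩
    rw [sum_zsmul_adjCol, real_inner_smul_left, sum_inner]
    simp only [real_inner_smul_left, inner_adjCol_vec, mul_ite, mul_zero, Finset.sum_ite_eq,
      Finset.mem_univ, if_true]
    rw [mul_comm ((z i : ℤ) : ℝ), ← mul_assoc, inv_mul_cancel₀ hD, one_mul]
  · intro h
    choose m hm using h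
    refine ⟨m, ?_⟩
    have hrec := sum_inner_vec_smul_adjCol (I := I) ((I.basis.det : ℝ)⁻¹ • x)
    rw [smul_smul, mul_inv_cancel₀ hD, one_smul] at hrec
    rw [sum_zsmul_adjCol, ← hrec]
    exact Finset.sum_congr rfl fun i _ ↦ by rw [hm i]

/-- **`L((adj B)ᵀ) = det B • L(B)*`** for `B` nonsingular. [cite: MicciancioGoldwasser2002, Ch. 1 §1 (dual basis `B⁻ᵀ`)] -/
theorem adjDualLattice_eq_smul (hI : I.IsNonsingular) :
    I.adjDualLattice = (I.basis.det : ℝ) • dualLattice I.lattice := by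
  have hD : (I.basis.det : ℝ) ≠ 0 := by exact_mod_cast hI
  ext x
  rw [mem_adjDualLattice_iff hI, Submodule.mem_smul_pointwise_iff_exists]
  constructor
  · intro h
    exact ⟨_, h, by rw [smul_smul, mul_inv_cancel₀ hD, one_smul]⟩
  · rintro ⟨y, hy, rfl⟩
    rwa [smul_smul, inv_mul_cancel₀ hD, one_smul]

/-- **The dual of the query lattice**: `L((adj B)ᵀ)* = (det B)⁻¹ • L(B)` (`L** = L`).
[cite: MicciancioGoldwasser2002, Ch. 1 §1] -/
theorem dualLattice_adjDualLattice (hI : I.IsNonsingular) :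
    dualLattice I.adjDualLattice = (I.basis.det : ℝ)⁻¹ • I.lattice := by
  have hD : (I.basis.det : ℝ) ≠ 0 := by exact_mod_cast hI
  haveI : IsZLattice ℝ I.lattice := isZLattice_of_isNonsingular hI
  rw [adjDualLattice_eq_smul hI, dualLattice_pointwise_smul _ hD, dualLattice_dualLattice]

/-- **Minimum distance of the dual of the query lattice**: `λ₁(L((adj B)ᵀ)*) = λ₁(L(B))/|det B|`.
[cite: MicciancioGoldwasser2002, Ch. 1 §1] -/
theorem minNorm_dualLattice_adjDualLattice (hI : I.IsNonsingular) :
    minNorm (dualLattice I.adjDualLattice) = minNorm I.lattice / |(I.basis.det : ℝ)| := by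
  have hD : (I.basis.det : ℝ) ≠ 0 := by exact_mod_cast hI
  rw [dualLattice_adjDualLattice hI, minNorm_pointwise_smul _ (inv_ne_zero hD), abs_inv, div_eq_inv_mul]

/-- **Regev's query is admissible exactly on the first NO condition of `GapCVP′`**: for `a ≥ 0`,
`b > 0` (in Lemma 3.20: `a = √n γ(n)`, `b = 100 d`), if `a · b < λ₁(L(B))` then
`a / λ₁(L((adj B)ᵀ)*) < |det B| / b`, i.e. the width `|det B|/(100d)` exceeds the `DGS` bound
`√n γ(n)/λ₁(·*)` (`Regev2009.dgsBoundDual`) of the query instance ("in the case of a NO instance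
we have `1/(100d) > √n γ(n)/λ₁(L)`, and hence `w₁, …, w_N` are guaranteed to be valid samples").
[cite: Regev2009, Lemma 3.20 (proof, p. 22)] -/
theorem div_minNorm_dualLattice_adjDualLattice_lt (hI : I.IsNonsingular) {a b : ℝ} (ha : 0 ≤ a) (hb : 0 < b)
    (h : a * b < minNorm I.lattice) :
    a / minNorm (dualLattice I.adjDualLattice) < |(I.basis.det : ℝ)| / b := by
  have hD : (I.basis.det : ℝ) ≠ 0 := by exact_mod_cast hI
  have hDpos : 0 < |(I.basis.det : ℝ)| := abs_pos.2 hD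
  have hlam : 0 < minNorm I.lattice := lt_of_le_of_lt (by positivity) h
  rw [minNorm_dualLattice_adjDualLattice hI, div_div_eq_mul_div, div_lt_div_iff₀ hlam hb]
  nlinarith

/-- **Genuine samples of the query are scaled dual samples**: for `B` nonsingular and `s > 0`, the
law `D_{L((adj B)ᵀ), |det B|/s}` on `ℝⁿ` is the image of the dual Gaussian
`D_{L(B)*, 1/s} = dualGaussian (L(B)) s` under `w ↦ det B · w`. (Stated for `adjDualLattice I`;
the law of the query instance `discreteGaussian (adjDual I).lattice` is the same term up to
`adjDual_lattice`.) [cite: Regev2009, Lemma 3.20 (proof)] [cite: MicciancioRegev2007, §2] -/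
theorem discreteGaussian_adjDualLattice_map_val (hI : I.IsNonsingular) [IsZLattice ℝ I.lattice] {s : ℝ} (hs : 0 < s) :
    (discreteGaussian I.adjDualLattice (|(I.basis.det : ℝ)| * s⁻¹) 0).map Subtype.val =
      (dualGaussian I.lattice s).map fun w : dualLattice I.lattice ↦
        (I.basis.det : ℝ) • (w : EuclideanSpace ℝ (Fin I.n)) :=
  discreteGaussian_map_val_eq_of_smul (by exact_mod_cast hI) (mem_adjDualLattice_iff hI) (inv_pos.2 hs)

end LatticeInstance

end Literature.Algebra.EuclideanLattices

end
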